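/-
Copyright (c) 2026 the pub-hodgecm-mathlib formalisation cell (harness21).  Prover seat hodgecm-mathlib-K2E2-p12 (g5): Track B «K2-LIT», ENGINE E1,
h413 = stmt-HodgeConjecture-24833; campaign EIS-R7-BL-SPH, deal (56) of K2E1-plan (g6): S-brick (S-β) «`R(h)` COMMUTES WITH `(·)_B`» for K2E4-p11's (ii′) payer.
-/
import Summits.HodgeConjecture.HodgeConjecture.Theorems.K2E1BLBorelOperatorsU2Defs          -- ★ `rightConvFun`, `zFun`, `rightShift_toBorelQuotient`, `borelQuotient`
import Literature.NumberTheory.Automorphic.UnitaryGroupBorelTruncation                        -- ★ `borelConstantTerm`, `constantTermTail`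
import Literature.NumberTheory.Automorphic.UnitaryGroupTruncatedTraceClassElliptic            -- ★ `secondCountableTopology_quasiSplitAdelic`
import Mathlib.MeasureTheory.Integral.Prod
import HarnessLib

/-!
# K2·E1 — `K2E1BLConstantTermSmoothingCommuteU` (deal (56), S-brick (S-β)): THE BOREL CONSTANT TERM COMMUTES WITH RIGHT CONVOLUTION — `(R(h)φ)_B = R(h)(φ_B)` — and with the
# constant-term TAIL `𝟙_{H>T}·φ_B` OFF THE COLLAR `T∕κ < H ≤ κT` [Rogawski1990 §2.1; Garrett2018 §2.10; arXiv:1911.02342 §4 p. 10]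

Track B ∕ K2-LIT, crux h413 = `stmt-HodgeConjecture-24833`, route of record `HCCMUnconditional`; cell `hodgecm-mathlib`, squad K2, ENGINE E1 (campaign EIS-R7-BL-SPH, P8 (ii′) payer
`K2E1BLContinuedMajorantU2` of K2E4-p11 (g5): its letter `hcomm`).  RANK-GENERIC (`(F, E, c, N)`).  THEOREMS ONLY (no `def`, no instance, no notation, no `sorry`; default heartbeats);
lane `--supports stmt-HodgeConjecture-24833 --as helper` (count-neutral).  TYPE NOTE (census 10:2xZ): ★ `borelConstantTerm ν 𝓕` acts on functions on `G(𝔸)` while ★ `rightConvFun νG h` acts on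
functions on `Z = B(F)﹨G(𝔸)`; the composable statement is the `G(𝔸)`-level one, `R_G(h)φ := fun x => ∫ h(y) φ(x y) dνG(y)`; the `Z`-level corollary follows through ★ `zFun` ∕ ★ `rightShift_toBorelQuotient`.
* §1 **`borelConstantTerm_rightConv_comm`** (HEAD, `hcomm`): `(R_G(h)φ)_B(g) = ∫ h(y)·φ_B(g y) dνG(y)` under the single joint-integrability side condition
  `hint : Integrable ((u,y) ↦ h y·φ(u g y)) ((ν|𝓕) × νG)` (Fubini — `N(𝔸)` acts on the left, `h` on the right).
* §2 `integrable_mul_comp_of_continuous` — `hint` from `φ` continuous, `h ∈ C_c`, `𝓕` measurable with compact closure, `ν`, `νG` finite on compacts; `borelConstantTerm_rightConv_comm_of_continuous`.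
* §3 `rightConvFun_zFun_borelConstantTerm` — the `Z`-level form `R(h)(zFun φ_B) = zFun ((R_G(h)φ)_B)` for left-`B(F)`-invariant `φ_B`.
* §4 `constantTermTail_rightConv_comm_of_lt` ∕ `_of_le` — `c_B^T(R_G(h)φ)(g) = R_G(h)(c_B^T φ)(g)` EXACTLY for `κT < H(g)` and for `κH(g) ≤ T` (`κ ≥ 1` the two-sided height distortion of `tsupport h`);
  across the collar `T∕κ < H(g) ≤ κT` no identity is asserted (it is false in general), hence none for `truncation`∕`pseudoEisenstein` either.
HONEST LABEL: HC_CM is proved only modulo the 7 printed citations (2 remaining named inputs: hLiu418 = `stmt-HodgeConjecture-24832`, h413 = `stmt-HodgeConjecture-24833`) until rung 0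
closes; this file asserts no named fact and closes no socket; count-neutral; unconditional measure theory.

## References
* [Rogawski1990] J. D. Rogawski, *Automorphic Representations of Unitary Groups in Three Variables* (1990): §2.1 (`φ_P`), §2.2.
* [Garrett2018] P. Garrett, *Modern Analysis of Automorphic Forms by Example* (2018): §2.10 (`c_P^T`, `Λ^T`).
* [BernsteinLapid2019] J. Bernstein, E. Lapid, *On the meromorphic continuation of Eisenstein series*, arXiv:1911.02342, §4 p. 10 (`δ(h)`).
-/

set_option autoImplicit false
set_option linter.dupNamespace false -- the mandated namespace repeats `HodgeConjecture.HodgeConjecture`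

noncomputable section

open MeasureTheory Filter Topology Set NumberField
open scoped NNReal ENNReal
open Literature.NumberTheory.Automorphic Literature.NumberTheory.Automorphic.UnitaryGroup AdelicGroupData
open Summit.HodgeConjecture.HodgeConjecture.Cruxes.H413.K2E1BLBorelSpacesU2Defs
open Summit.HodgeConjecture.HodgeConjecture.Cruxes.H413.K2E1BLBorelOperatorsU2Defs

namespace Summit.HodgeConjecture.HodgeConjecture.Cruxes.H413.K2E1BLConstantTermSmoothingCommuteU

variable {F E : Type} [Field F] [NumberField F] [Field E] [NumberField E] [Algebra F E] {c : E ≃ₐ[F] E} {N : ℕ}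
variable [MeasurableSpace (adelicUnipotent F E c N)] [MeasurableSpace (quasiSplit F E c N).Adelic]

/-! ## §1 `(R(h)φ)_B = R(h)(φ_B)` (Fubini) -/

/-- **THE BOREL CONSTANT TERM COMMUTES WITH RIGHT CONVOLUTION** (`hcomm`): for `h, φ : G(𝔸) → ℂ`, a measure `ν` on `N(𝔸)` with a set `𝓕`, a measure `νG` on `G(𝔸)` and `g ∈ G(𝔸)`,
if `(u, y) ↦ h(y)·φ(u g y)` is integrable for `(ν|_𝓕) × νG` then `(R_G(h)φ)_B(g) = ∫ h(y)·φ_B(g y) dνG(y)`, where `R_G(h)φ(x) = ∫ h(y) φ(x y) dνG(y)` and `φ_B = borelConstantTerm ν 𝓕 φ`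
(`N(𝔸)` acts on the left, `h` on the right: Fubini). [cite: Rogawski1990, §2.1] [cite: BernsteinLapid2019, §4 p. 10] -/
theorem borelConstantTerm_rightConv_comm (ν : Measure (adelicUnipotent F E c N)) [SFinite ν] (𝓕 : Set (adelicUnipotent F E c N))
    (νG : Measure (quasiSplit F E c N).Adelic) [SFinite νG] (h φ : (quasiSplit F E c N).Adelic → ℂ) (g : (quasiSplit F E c N).Adelic)
    (hint : Integrable (fun p : adelicUnipotent F E c N × (quasiSplit F E c N).Adelic => h p.2 * φ ((p.1 : (quasiSplit F E c N).Adelic) * g * p.2)) ((ν.restrict 𝓕).prod νG)) :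
    borelConstantTerm ν 𝓕 (fun x => ∫ y, h y * φ (x * y) ∂νG) g = ∫ y, h y * borelConstantTerm ν 𝓕 φ (g * y) ∂νG := by
  simp only [borelConstantTerm_def]
  calc ((ν 𝓕).toReal⁻¹ : ℝ) • ∫ u in 𝓕, ∫ y, h y * φ ((u : (quasiSplit F E c N).Adelic) * g * y) ∂νG ∂ν
      = ((ν 𝓕).toReal⁻¹ : ℝ) • ∫ y, ∫ u in 𝓕, h y * φ ((u : (quasiSplit F E c N).Adelic) * g * y) ∂ν ∂νG := by
        rw [integral_integral_swap hint]
    _ = ∫ y, ((ν 𝓕).toReal⁻¹ : ℝ) • (h y * ∫ u in 𝓕, φ ((u : (quasiSplit F E c N).Adelic) * g * y) ∂ν) ∂νG := by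
        rw [← integral_smul]
        refine integral_congr_ae (Eventually.of_forall fun y => ?_)
        dsimp only
        rw [integral_const_mul]
    _ = ∫ y, h y * (((ν 𝓕).toReal⁻¹ : ℝ) • ∫ u in 𝓕, φ ((u : (quasiSplit F E c N).Adelic) * (g * y)) ∂ν) ∂νG := by
        refine integral_congr_ae (Eventually.of_forall fun y => ?_)
        simp only [mul_assoc, Complex.real_smul]
        ring

/-! ## §2 The side condition from continuity and compact support -/

variable [BorelSpace (adelicUnipotent F E c N)] [BorelSpace (quasiSplit F E c N).Adelic]

/-- **THE SIDE CONDITION `hint` HOLDS** for `φ` continuous, `h` continuous of compact support, `𝓕` measurable of compact closure, and `ν`, `νG` finite on compacts: the integrand is continuous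
and dominated by `M·𝟙_{tsupport h}(y)` on the finite measure space `(ν|_𝓕) × νG|_{tsupport h}`. [cite: Rogawski1990, §2.1] -/
theorem integrable_mul_comp_of_continuous (ν : Measure (adelicUnipotent F E c N)) [IsFiniteMeasureOnCompacts ν] [SFinite ν] {𝓕 : Set (adelicUnipotent F E c N)}
    (h𝓕 : MeasurableSet 𝓕) (h𝓕c : IsCompact (closure 𝓕))
    (νG : Measure (quasiSplit F E c N).Adelic) [IsFiniteMeasureOnCompacts νG] [SFinite νG] {h φ : (quasiSplit F E c N).Adelic → ℂ}
    (hh : Continuous h) (hhs : HasCompactSupport h) (hφ : Continuous φ) (g : (quasiSplit F E c N).Adelic) :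
    Integrable (fun p : adelicUnipotent F E c N × (quasiSplit F E c N).Adelic => h p.2 * φ ((p.1 : (quasiSplit F E c N).Adelic) * g * p.2)) ((ν.restrict 𝓕).prod νG) := by
  haveI := secondCountableTopology_quasiSplitAdelic (F := F) (E := E) (c := c) (N := N)
  -- continuity of the integrand
  have hFc : Continuous fun p : adelicUnipotent F E c N × (quasiSplit F E c N).Adelic => h p.2 * φ ((p.1 : (quasiSplit F E c N).Adelic) * g * p.2) :=
    (hh.comp continuous_snd).mul (hφ.comp (((continuous_subtype_val.comp continuous_fst).mul continuous_const).mul continuous_snd))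
  -- a uniform bound on `closure 𝓕 × tsupport h`
  obtain ⟨M, hM⟩ := (h𝓕c.prod hhs.isCompact).exists_bound_of_continuousOn (f := fun p : adelicUnipotent F E c N × (quasiSplit F E c N).Adelic =>
    h p.2 * φ ((p.1 : (quasiSplit F E c N).Adelic) * g * p.2)) hFc.continuousOn
  -- the dominating function `M · 𝟙_{tsupport h}(y)` is integrable on the finite part
  have hfin𝓕 : ν 𝓕 < ⊤ := (measure_mono subset_closure).trans_lt h𝓕c.measure_lt_top
  haveI : IsFiniteMeasure (ν.restrict 𝓕) := ⟨by rwa [Measure.restrict_apply_univ]⟩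
  have hKm : MeasurableSet ((Set.univ : Set (adelicUnipotent F E c N)) ×ˢ tsupport h) := MeasurableSet.univ.prod (isClosed_tsupport h).measurableSet
  have hKfin : ((ν.restrict 𝓕).prod νG) ((Set.univ : Set (adelicUnipotent F E c N)) ×ˢ tsupport h) ≠ ⊤ := by
    rw [Measure.prod_prod, Measure.restrict_apply_univ]
    exact ENNReal.mul_ne_top hfin𝓕.ne hhs.isCompact.measure_lt_top.ne
  have hdom : Integrable (fun p : adelicUnipotent F E c N × (quasiSplit F E c N).Adelic => ((Set.univ : Set (adelicUnipotent F E c N)) ×ˢ tsupport h).indicator (fun _ => M) p)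
      ((ν.restrict 𝓕).prod νG) :=
    (integrable_indicator_iff hKm).2 (integrableOn_const hKfin)
  -- a.e. `p.1 ∈ 𝓕`, and the pointwise domination there
  have hae : ∀ᵐ p : adelicUnipotent F E c N × (quasiSplit F E c N).Adelic ∂((ν.restrict 𝓕).prod νG), p.1 ∈ 𝓕 :=
    (Measure.quasiMeasurePreserving_fst (μ := ν.restrict 𝓕) (ν := νG)).ae (ae_restrict_mem h𝓕)
  refine hdom.mono' hFc.aestronglyMeasurable (hae.mono fun p hp => ?_)
  by_cases hy : p.2 ∈ tsupport h
  · rw [Set.indicator_of_mem (Set.mk_mem_prod (Set.mem_univ _) hy)]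
    exact hM p (Set.mk_mem_prod (subset_closure hp) hy)
  · rw [Set.indicator_of_notMem (fun hmem => hy (Set.mem_prod.1 hmem).2), image_eq_zero_of_notMem_tsupport hy, zero_mul, norm_zero]

/-- **`(R(h)φ)_B = R(h)(φ_B)` FOR CONTINUOUS `φ` AND `h ∈ C_c`** (`𝓕` measurable of compact closure; `ν`, `νG` finite on compacts). [cite: Rogawski1990, §2.1] [cite: BernsteinLapid2019, §4 p. 10] -/
theorem borelConstantTerm_rightConv_comm_of_continuous (ν : Measure (adelicUnipotent F E c N)) [IsFiniteMeasureOnCompacts ν] [SFinite ν] {𝓕 : Set (adelicUnipotent F E c N)}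
    (h𝓕 : MeasurableSet 𝓕) (h𝓕c : IsCompact (closure 𝓕))
    (νG : Measure (quasiSplit F E c N).Adelic) [IsFiniteMeasureOnCompacts νG] [SFinite νG] {h φ : (quasiSplit F E c N).Adelic → ℂ}
    (hh : Continuous h) (hhs : HasCompactSupport h) (hφ : Continuous φ) (g : (quasiSplit F E c N).Adelic) :
    borelConstantTerm ν 𝓕 (fun x => ∫ y, h y * φ (x * y) ∂νG) g = ∫ y, h y * borelConstantTerm ν 𝓕 φ (g * y) ∂νG :=
  borelConstantTerm_rightConv_comm ν 𝓕 νG h φ g (integrable_mul_comp_of_continuous ν h𝓕 h𝓕c νG hh hhs hφ g)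

/-! ## §3 The `Z`-level form -/

omit [BorelSpace (adelicUnipotent F E c N)] [BorelSpace (quasiSplit F E c N).Adelic] in
/-- **`R(h)(zFun φ_B) = zFun ((R_G(h)φ)_B)` ON `Z = B(F)﹨G(𝔸)`** for a left-`B(F)`-invariant constant term `φ_B` (so that ★ `zFun` is the honest descent) and under the side condition of §1 at
every point. [cite: BernsteinLapid2019, §4 p. 10] -/
theorem rightConvFun_zFun_borelConstantTerm [NeZero N] (ν : Measure (adelicUnipotent F E c N)) [SFinite ν] (𝓕 : Set (adelicUnipotent F E c N))
    (νG : Measure (quasiSplit F E c N).Adelic) [SFinite νG] (h φ : (quasiSplit F E c N).Adelic → ℂ)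
    (hB : ∀ γ ∈ ratBorelSubgroup F E c N, ∀ g, borelConstantTerm ν 𝓕 φ (γ * g) = borelConstantTerm ν 𝓕 φ g)
    (hint : ∀ g : (quasiSplit F E c N).Adelic,
      Integrable (fun p : adelicUnipotent F E c N × (quasiSplit F E c N).Adelic => h p.2 * φ ((p.1 : (quasiSplit F E c N).Adelic) * g * p.2)) ((ν.restrict 𝓕).prod νG))
    (g : (quasiSplit F E c N).Adelic) :
    rightConvFun F E c N νG h (zFun F E c N (borelConstantTerm ν 𝓕 φ)) (toBorelQuotient F E c N g) =
      zFun F E c N (borelConstantTerm ν 𝓕 (fun x => ∫ y, h y * φ (x * y) ∂νG)) (toBorelQuotient F E c N g) := by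
  have hB' : ∀ γ ∈ ratBorelSubgroup F E c N, ∀ g, borelConstantTerm ν 𝓕 (fun x => ∫ y, h y * φ (x * y) ∂νG) (γ * g) =
      borelConstantTerm ν 𝓕 (fun x => ∫ y, h y * φ (x * y) ∂νG) g := fun γ hγ g => by
    rw [borelConstantTerm_rightConv_comm ν 𝓕 νG h φ _ (hint _), borelConstantTerm_rightConv_comm ν 𝓕 νG h φ _ (hint _)]
    simp_rw [mul_assoc, hB γ hγ]
  rw [zFun_toBorelQuotient F E c N hB', borelConstantTerm_rightConv_comm ν 𝓕 νG h φ g (hint g)]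
  simp only [rightConvFun, rightShift_toBorelQuotient, zFun_toBorelQuotient F E c N hB]

/-! ## §4 The constant-term tail commutes with `R(h)` off the collar -/

omit [BorelSpace (adelicUnipotent F E c N)] [BorelSpace (quasiSplit F E c N).Adelic] in
/-- **ABOVE THE COLLAR** (`κ·T < H(g)`, `κ ≥ 1` a two-sided height distortion constant of `tsupport h`): `c_B^T(R_G(h)φ)(g) = ∫ h(y)·c_B^T φ(g y) dνG(y)` — both sides are the full
constant terms, since `H(g) > κT ≥ T` and `H(g y) ≥ H(g)∕κ > T` on `tsupport h`. [cite: Garrett2018, §2.10] [cite: BernsteinLapid2019, §4 p. 10] -/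
theorem constantTermTail_rightConv_comm_of_lt [NeZero N] (ν : Measure (adelicUnipotent F E c N)) [SFinite ν] (𝓕 : Set (adelicUnipotent F E c N))
    (νG : Measure (quasiSplit F E c N).Adelic) [SFinite νG] (h φ : (quasiSplit F E c N).Adelic → ℂ) {κ : ℝ≥0} (hκ : 1 ≤ κ)
    (hκh : ∀ y ∈ tsupport h, ∀ x : (quasiSplit F E c N).Adelic, borelHeight x ≤ κ * borelHeight (x * y)) (T : ℝ≥0)
    (g : (quasiSplit F E c N).Adelic) (hg : κ * T < borelHeight g)
    (hint : Integrable (fun p : adelicUnipotent F E c N × (quasiSplit F E c N).Adelic => h p.2 * φ ((p.1 : (quasiSplit F E c N).Adelic) * g * p.2)) ((ν.restrict 𝓕).prod νG)) :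
    constantTermTail ν 𝓕 T (fun x => ∫ y, h y * φ (x * y) ∂νG) g = ∫ y, h y * constantTermTail ν 𝓕 T φ (g * y) ∂νG := by
  have hκ0 : 0 < κ := lt_of_lt_of_le one_pos hκ
  have hgT : T < borelHeight g := lt_of_le_of_lt (le_mul_of_one_le_left (by positivity) hκ) hg
  rw [constantTermTail, Set.indicator_of_mem (show g ∈ {x : (quasiSplit F E c N).Adelic | T < borelHeight x} from hgT),
    borelConstantTerm_rightConv_comm ν 𝓕 νG h φ g hint]
  refine integral_congr_ae (Eventually.of_forall fun y => ?_)
  dsimp only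
  by_cases hy : y ∈ tsupport h
  · rw [constantTermTail, Set.indicator_of_mem (show g * y ∈ {x : (quasiSplit F E c N).Adelic | T < borelHeight x} from
      lt_of_mul_lt_mul_left (hg.trans_le (hκh y hy g)) hκ0.le)]
  · simp only [image_eq_zero_of_notMem_tsupport hy, zero_mul]

omit [BorelSpace (adelicUnipotent F E c N)] [BorelSpace (quasiSplit F E c N).Adelic] in
/-- **BELOW THE COLLAR** (`κ·H(g) ≤ T`): `c_B^T(R_G(h)φ)(g) = ∫ h(y)·c_B^T φ(g y) dνG(y) = 0` — `H(g) ≤ T` and `H(g y) ≤ κ H(g) ≤ T` on `tsupport h`. [cite: Garrett2018, §2.10] -/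
theorem constantTermTail_rightConv_comm_of_le [NeZero N] (ν : Measure (adelicUnipotent F E c N)) (𝓕 : Set (adelicUnipotent F E c N))
    (νG : Measure (quasiSplit F E c N).Adelic) (h φ : (quasiSplit F E c N).Adelic → ℂ) {κ : ℝ≥0} (hκ : 1 ≤ κ)
    (hκh : ∀ y ∈ tsupport h, ∀ x : (quasiSplit F E c N).Adelic, borelHeight (x * y) ≤ κ * borelHeight x) (T : ℝ≥0)
    (g : (quasiSplit F E c N).Adelic) (hg : κ * borelHeight g ≤ T) :
    constantTermTail ν 𝓕 T (fun x => ∫ y, h y * φ (x * y) ∂νG) g = ∫ y, h y * constantTermTail ν 𝓕 T φ (g * y) ∂νG := by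
  have hgT : ¬ T < borelHeight g := not_lt.2 ((le_mul_of_one_le_left (by positivity) hκ).trans hg)
  rw [constantTermTail, Set.indicator_of_notMem (show g ∉ {x : (quasiSplit F E c N).Adelic | T < borelHeight x} from hgT)]
  symm
  refine (integral_congr_ae (Eventually.of_forall fun y => ?_)).trans (integral_zero _ _)
  by_cases hy : y ∈ tsupport h
  · rw [constantTermTail, Set.indicator_of_notMem (show g * y ∉ {x : (quasiSplit F E c N).Adelic | T < borelHeight x} from
      not_lt.2 ((hκh y hy g).trans hg)), mul_zero]
  · simp only [image_eq_zero_of_notMem_tsupport hy, zero_mul]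

end Summit.HodgeConjecture.HodgeConjecture.Cruxes.H413.K2E1BLConstantTermSmoothingCommuteU

end
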